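import Summits.RiemannHypothesis.RiemannHypothesis.Theorems.PfPersistenceDialMatching
import Summits.RiemannHypothesis.RiemannHypothesis.Theorems.PfPersistenceArithDialSpace
import HarnessLib

/-!
# PF persistence — the locality barrier at bounded height on the ARITHMETIC dial space (pub-rhpf, barrier-typer gen 3)

**HONEST FRAMING. This is a long-odds MECHANISM SEARCH; no RH claims.** Every statement below is RH-free
bookkeeping about the cell's observatory records; nothing here bears on the truth of RH.

`PfPersistenceSectorLocality` proves the locality barrier for classes decided below a height `A`
(`exists_heavyDial_mem_negative_of_determinedOn_below`, witness a heavy PRIME dial at `p > e^{2A}`) and its set form on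
the integer dial space. RULING A35(a) fixes the ARITHMETIC dial space `arithDialSpace` (`PfPersistenceArithDialSpace`:
von-Mangoldt-supported tables) as the comparison domain of record; since the witness is a prime dial, the set forms
hold there verbatim:

* `determinedOn_below_meets_arithDialNegativesNe` (PROVED): a class decided below some height and containing `ζ`'s
  datum contains an ARITHMETIC dial-space datum `≠ ζ`, detectably negative at a genuine window;
* `not_separates_of_determinedOn_below_arith` (PROVED): wall W1 at bounded height on any domain `⊇ arithDialSpace`
  — the theorem behind the rows "FIXED finite family of tests at height `a₀`, all `N`" (`DeterminedOn S (below a₀)`);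
* `nonlocalAtEveryHeight_of_separates` (PROVED): a class that separates on a domain `⊇ arithDialSpace` is nonlocal at
  every height — clause (2) of the gap class `G1` (`NonlocalAtEveryHeight`) is NECESSARY for separation.
* §2 (dial matching, `PfPersistenceDialMatching`, RULING A42): the matched witnesses are composites of prime dials of
  `ζ`, hence ARITHMETIC (`multiDial_mem_arithWeights`, `datumOf_multiDial_zeta_mem_arithDialSpace`); the non-separation
  statements on any domain `⊇ arithDialSpace`: `FactorsThrough.not_separates_arith` (under the TYPED hypothesis
  `ExactMultiDialMatching F`), `FactorsThrough.not_separates_of_determinedBelow_arith` (bounded-height readers, PROVED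
  outright), `not_separates_of_marginClass_subset_arith` (margin readers, modulo `DialReady`).
-/

set_option linter.dupNamespace false  -- the mandated namespace repeats `RiemannHypothesis`

noncomputable section

open Real Finset Matrix

namespace Summit.RiemannHypothesis.RiemannHypothesis.Theorems.PfPersistence

/-- **PROVED (set form, arithmetic domain of record):** a class decided below some height and containing `ζ`'s
datum contains an ARITHMETIC dial-space datum `≠ ζ` that is in the class and detectably negative. [folklore] -/
theorem determinedOn_below_meets_arithDialNegativesNe {S : Set Datum} {A : ℝ} (hS : DeterminedOn S (below A))
    (hζ : zetaDatum ∈ S) : ∃ d ∈ arithDialSpace, d ≠ zetaDatum ∧ d ∈ S ∧ DetectablyNegative d := by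
  obtain ⟨p, hp, K, hK, hmem, v, hv⟩ := exists_heavyDial_mem_negative_of_determinedOn_below hS hζ
  exact ⟨datumOf (dial p K zetaWeights), datumOf_dial_zeta_mem_arithDialSpace p K,
    datumOf_dial_ne hp.two_le hK.ne' (zetaWeights_pos_of_prime hp).ne', hmem, logWindow p hp.two_le, v, hv⟩

/-- **PROVED — WALL W1 AT BOUNDED HEIGHT on the arithmetic domain:** a class decided by the windows of height `≤ A`
cannot separate `ζ` from the detectably negative data on any domain `D ⊇ arithDialSpace`. [folklore] -/
theorem not_separates_of_determinedOn_below_arith {S D : Set Datum} {A : ℝ} (hD : arithDialSpace ⊆ D)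
    (hS : DeterminedOn S (below A)) : ¬ Separates S D zetaDatum := by
  rintro ⟨hζ, hsep⟩
  obtain ⟨d, hd, -, hdS, hneg⟩ := determinedOn_below_meets_arithDialNegativesNe hS hζ
  exact hsep d (hD hd) hneg hdS

/-- PROVED (the three typed domains): on `originFreeDialSpace` and on `dialSpace` by monotonicity. [folklore] -/
theorem not_separates_of_determinedOn_below_originFree {S D : Set Datum} {A : ℝ}
    (hD : originFreeDialSpace ⊆ D) (hS : DeterminedOn S (below A)) : ¬ Separates S D zetaDatum :=
  not_separates_of_determinedOn_below_arith (arithDialSpace_subset_originFreeDialSpace.trans hD) hS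

/-- **PROVED — clause (2) of `G1` is NECESSARY:** a class that separates `ζ` from the detectably negative data on a
domain `⊇ arithDialSpace` is not decided below any height (`NonlocalAtEveryHeight`, gap-class file). [folklore] -/
theorem nonlocalAtEveryHeight_of_separates {S D : Set Datum} (hD : arithDialSpace ⊆ D)
    (h : Separates S D zetaDatum) : NonlocalAtEveryHeight S :=
  fun _ hA => not_separates_of_determinedOn_below_arith hD hA h

/-- PROVED (contrapositive reading for the rows): a class decided below height `A` is not in `G1` (it fails clause (2)),
whatever its per-window content. [folklore] -/
theorem not_nonlocalAtEveryHeight_of_determinedOn_below {S : Set Datum} {A : ℝ} (hS : DeterminedOn S (below A)) :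
    ¬ NonlocalAtEveryHeight S :=
  fun h => h A hS

/-! ## §2 Dial matching on the arithmetic domain of record -/

/-- PROVED: composites of dials preserve arithmetic support. [folklore] -/
theorem multiDial_mem_arithWeights {L : List (ℕ × ℝ)} {w : Weights} (hw : w ∈ arithWeights) :
    multiDial L w ∈ arithWeights := by
  induction L with
  | nil => exact hw
  | cons pk L ih =>
    obtain ⟨p, K⟩ := pk
    exact dial_mem_arithWeights p K ih

/-- PROVED: multi-dial data of `ζ` are arithmetic dial-space data. [folklore] -/
theorem datumOf_multiDial_zeta_mem_arithDialSpace (L : List (ℕ × ℝ)) :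
    datumOf (multiDial L zetaWeights) ∈ arithDialSpace :=
  ⟨_, multiDial_mem_arithWeights zetaWeights_mem_arithWeights, rfl⟩

/-- **PROVED (use of the TYPED matching hypothesis, arithmetic domain):** a class factoring through an exactly matched
reader cannot separate `ζ` on any domain `⊇ arithDialSpace`. [folklore] -/
theorem FactorsThrough.not_separates_arith {ρ : Type} {S : Set Datum} {F : Datum → ρ} (hF : FactorsThrough S F)
    (hM : ExactMultiDialMatching F) {D : Set Datum} (hD : arithDialSpace ⊆ D) : ¬ Separates S D zetaDatum := by
  rintro ⟨hζ, hsep⟩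
  obtain ⟨L, -, -, hFeq, hneg⟩ := hM
  exact hsep _ (hD (datumOf_multiDial_zeta_mem_arithDialSpace L)) hneg ((hF _ _ hFeq).2 hζ)

/-- **PROVED (bounded-height readers, arithmetic domain):** a class factoring through a reader of the windows of height
`≤ A` cannot separate `ζ` on any domain `⊇ arithDialSpace` — exact matching by one heavy prime dial. [folklore] -/
theorem FactorsThrough.not_separates_of_determinedBelow_arith {ρ : Type} {S : Set Datum} {F : Datum → ρ} {A : ℝ}
    (hS : FactorsThrough S F) (hF : ∀ d d' : Datum, (∀ win ∈ below A, d win = d' win) → F d = F d')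
    {D : Set Datum} (hD : arithDialSpace ⊆ D) : ¬ Separates S D zetaDatum :=
  hS.not_separates_arith (exactMultiDialMatching_of_determinedBelow hF) hD

/-- **PROVED (margin readers, arithmetic domain, modulo `DialReady`):** a class containing a margin class of a reader
continuous at `ζ` cannot separate `ζ` on any domain `⊇ arithDialSpace` — tolerance matching by ONE prime dial (W2). [folklore] -/
theorem not_separates_of_marginClass_subset_arith {k : ℕ} {F : Datum → Fin k → ℝ}
    (hF : ReaderContinuousAt F zetaDatum) {η : ℝ} (hη : 0 < η) {S D : Set Datum} (hS : marginClass F η ⊆ S)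
    (hD : arithDialSpace ⊆ D) {p : ℕ} {β₀ : ℝ} (hβ₀ : 0 < β₀) (hw : 0 < zetaWeights p) (hready : DialReady p β₀) :
    ¬ Separates S D zetaDatum :=
  not_separates_of_uniformlyRobust_arith hβ₀ hw hready hD (uniformlyRobustAt_of_marginClass_subset hF hη hS)

end Summit.RiemannHypothesis.RiemannHypothesis.Theorems.PfPersistence

end
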